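import Summits.ResolutionOfSingularities.ResolutionOfSingularities.Theorems.EquisingularLiftEquisingularLiftNatNoseResidueStrictTransformCurve
import Summits.ResolutionOfSingularities.ResolutionOfSingularities.Theorems.EquisingularLiftEquisingularLiftNatNoseResidueSingularLocusThree
import HarnessLib

/-!
# [OURS · L1 W4.5(b) · EL♮(3)] NOSE RESIDUE STRUCTURE, brick 10a — in `ℙⁿ_k` the CURVE CLAUSE forces infinitude: `Z ≠ ∅` with one-dimensional local
# rings at the closed points of `Z̃` ⇒ `Z` infinite (support for crit-3's sharpening S-T51 of NOSE WORD v1: the blob clause `Z.Infinite` is implied)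

Cell `res-hironaka`, rung L, slot W4.5(b), D-0157 DOOR 1 width seat `res-L1-w45b-nose-w4` (NOSE WORD v1 / TRIAGE-r41-3 S-T51); crux CHILD EL♮(3) =
stmt-ResolutionOfSingularities-20148. OURS; NOT a statement of any manuscript; nothing of [Hironaka2017] is asserted or used; AI kernel work, weaker than expert
review. Resolution of singularities in positive characteristic is NOT proved here (dimension 3 is a theorem in print, Cossart–Piltant 2008/2009). No `sorry`, no new
definition, no instance, no notation; standard axioms. `--kind proof --supports stmt-ResolutionOfSingularities-20148 --as helper`.

* `infinite_of_nonempty_of_curveClause` — `k` any field, `Z ⊆ ℙⁿ_k` closed and non-empty whose reduced subscheme `Z̃ = redSub ℙⁿ Z hZ` has `dim 𝒪_{Z̃,z} = 1` at every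
  closed point: then `Z` is INFINITE.  (If `Z` were finite, all its points would be closed — `ℙⁿ_k` is Jacobson —, `Z̃` would be a finite `T₁` hence DISCRETE space,
  so `topologicalKrullDim Z̃ ≤ 0` (Mathlib `topologicalKrullDim_zero_of_discreteTopology`) and every stalk would have dimension `≤ 0`
  (`ringKrullDim_stalk_le_topologicalKrullDim`), contradicting the clause at any point.)  Hence in the nose blobs (`ReachNoseTower₇/B/B′/B″/B‴`, NOSE WORD's ν1/ν2)
  the clause `Z.Infinite` follows from `Z.Nonempty` + the curve clause (crit-3 S-T51); the converse direction is brick 2/9.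
-/

set_option linter.dupNamespace false

noncomputable section

open CategoryTheory CategoryTheory.Limits AlgebraicGeometry TopologicalSpace Topology IsLocalRing
open Literature.AlgebraicGeometry.Resolution
open Literature.AlgebraicGeometry.Motives
open AlgebraicGeometry.Scheme.IdealSheafData
open Summit.ResolutionOfSingularities.ResolutionOfSingularities.Cruxes.EquisingularLift.StrataSplit

namespace Summit.ResolutionOfSingularities.ResolutionOfSingularities.Cruxes.EquisingularLiftNat.Sections

/-- **The curve clause forces infinitude in `ℙⁿ_k`.** For a closed non-empty `Z ⊆ ℙⁿ_k` whose reduced subscheme has one-dimensional local rings at all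
closed points, `Z` is infinite. [folklore] -/
theorem infinite_of_nonempty_of_curveClause (k : Type) [Field k] (n : ℕ) {Z : Set (projectiveSpace n k).left} (hZ : IsClosed Z)
    (hne : Z.Nonempty)
    (hcurve : ∀ z : ↥(redSub (projectiveSpace n k).left Z hZ), IsClosed ({z} : Set ↥(redSub (projectiveSpace n k).left Z hZ)) →
      ringKrullDim ((redSub (projectiveSpace n k).left Z hZ).presheaf.stalk z) = ((1 : ℕ) : WithBot ℕ∞)) :
    Z.Infinite := by
  intro hfin
  haveI : IsProper (projectiveSpace n k).hom := isProper_projectiveSpace n k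
  haveI : JacobsonSpace ↥(projectiveSpace n k).left := LocallyOfFiniteType.jacobsonSpace (projectiveSpace n k).hom
  -- every point of `Z̃` lies over a point of `Z`, which is closed in `ℙⁿ_k`; hence every point of `Z̃` is closed
  have hmem : ∀ s : ↥(redSub (projectiveSpace n k).left Z hZ), (redSubι (projectiveSpace n k).left Z hZ s : (projectiveSpace n k).left) ∈ Z := by
    intro s
    have h : (redSubι (projectiveSpace n k).left Z hZ s : (projectiveSpace n k).left) ∈ Set.range (redSubι (projectiveSpace n k).left Z hZ) :=
      Set.mem_range_self s
    rwa [range_subschemeι_vanishingIdeal] at h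
  have hcl : ∀ s : ↥(redSub (projectiveSpace n k).left Z hZ), IsClosed ({s} : Set ↥(redSub (projectiveSpace n k).left Z hZ)) := fun s =>
    isClosed_singleton_redSub_of_isClosed Z hZ s
      (Summit.ResolutionOfSingularities.ResolutionOfSingularities.Theorems.SigmaMaxModificationsCorridor3.IsoTailsHS.isClosed_singleton_of_mem_finite_closed
        hZ hfin (hmem s))
  -- `Z̃` is a finite `T₁` space, hence discrete, hence zero-dimensional
  haveI : Finite Z := hfin.to_subtype
  haveI : Finite ↥(redSub (projectiveSpace n k).left Z hZ) :=
    Finite.of_injective (fun s => (⟨redSubι (projectiveSpace n k).left Z hZ s, hmem s⟩ : Z)) fun a b hab =>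
      (redSubι (projectiveSpace n k).left Z hZ).isClosedEmbedding.injective (congrArg Subtype.val hab)
  haveI : T1Space ↥(redSub (projectiveSpace n k).left Z hZ) := ⟨hcl⟩
  have h0 : topologicalKrullDim ↥(redSub (projectiveSpace n k).left Z hZ) ≤ 0 := topologicalKrullDim_zero_of_discreteTopology _
  -- but the stalk at any point has dimension `1`
  obtain ⟨z₀, hz₀⟩ := hne
  have hz₀' : z₀ ∈ Set.range (redSubι (projectiveSpace n k).left Z hZ) := by rw [range_subschemeι_vanishingIdeal]; exact hz₀
  obtain ⟨s, -⟩ := hz₀'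
  have h1 := hcurve s (hcl s)
  have hle := ringKrullDim_stalk_le_topologicalKrullDim (redSub (projectiveSpace n k).left Z hZ) s
  rw [h1] at hle
  have h10 : ((1 : ℕ) : WithBot ℕ∞) ≤ 0 := hle.trans h0
  exact absurd h10 (by decide)

end Summit.ResolutionOfSingularities.ResolutionOfSingularities.Cruxes.EquisingularLiftNat.Sections

end
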